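import Summits.CriticalPhenomena.PercolationContinuityZ3.Theorems.Transplant.AutCocompactFinitelyGeneratedDichotomy
import Summits.CriticalPhenomena.PercolationContinuityZ3.Theorems.Transplant.BenjaminiSchrammResidue
import Literature.Probability.Percolation.UniquenessAmenable
import HarnessLib

/-!
# `p_u = p_c` for EVERY cocompact action of a virtually nilpotent group, and `p_u < 1` (the amenable half of Benjamini–Schramm Question 3 /
# Lyons–Peres Conj. 7.27) for the lane's C2 action class

builds on p205010 (kernel theorem, internal audit signed; external expert review pending) — NOT used in this file.  Lane `prim-bschramm`, seat
`prim-bschramm-stmt` gen 38 (stmt port pen; lead g25 GO #7773 with the placement split: the published fact `p_u = p_c` on amenable quasi-transitive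
graphs lives in `Literature.Probability.Percolation.UniquenessAmenable`, the class rows here).  Helper file (`--supports stmt-CriticalPhenomena-4575
--as helper`); PROOFS ONLY (def-free, no `instance`, no notation).  NOT by-name: the OPEN print nodes `BenjaminiSchramm1996_question3` / `…_question3_site`
/ `LyonsPeres2016_conj_7_27` («StatementTransitiveGraphConjectures») are NOT closed — their hypothesis is 'one end', with no amenability; one-endedness is
not linked here and the site forms would need a site Burton–Keane the tree lacks; STATEMENTS §5 counts unchanged; nothing about
`BenjaminiSchramm1996_conj4_endState`, nothing about Conjecture 6; bond percolation only.

* `isGraphAmenable_of_virtuallyNilpotent_cocompact` — a connected locally finite graph with an action by automorphisms with finitely many orbits of a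
  VIRTUALLY NILPOTENT group (nothing else assumed) is AMENABLE: quasi-transitive by the action (`AutChart.isQuasiTransitive_of_finite_orbits`), of
  polynomial growth by gen-1 g6's cocompact growth transfer `AutChart.exists_polynomialGrowth_of_cocompact` restricted to the nilpotent finite-index
  subgroup (`exists_reps_of_finiteIndex`) + Wolf's theorem from the tree's Literature (`ballVolume_mulCayley_le_polynomial_of_isNilpotent`), hence not of
  exponential growth (`not_hasExponentialGrowth_of_polynomialGrowth`, «BenjaminiSchrammResidue» §1), hence amenable (contrapositive of the Literature
  `hasExponentialGrowth_of_not_isGraphAmenable`).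
* `uniquenessProb_eq_criticalProb_of_virtuallyNilpotent_cocompact` — `p_u = p_c(x)` for every such action (Literature
  `uniquenessProb_eq_criticalProb_of_amenable`).
* `uniquenessProb_lt_one_of_fg_virtuallyNilpotent_cocompact` — for a FINITELY GENERATED virtually nilpotent group: `p_u < 1` unless some element acts with
  finite index modulo the kernel (the dichotomy «AutCocompactFinitelyGeneratedDichotomy» p596130).
[cite: LyonsPeres2016, Thm. 7.6, §7.5 (7.7), Conj. 7.27] [cite: BenjaminiSchramm1996, §2 (p. 73), Question 3 (p. 79)] [cite: WolfGrowth1968, Thm. 3.2]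
[cite: Woess2000, Lemma 3.13]
-/

noncomputable section

namespace Summit.CriticalPhenomena.PercolationContinuityZ3.Theorems.Transplant

open MeasureTheory SimpleGraph Literature.Barriers.CriticalPhenomena Literature.Probability.LatticeModels Literature.Probability.Percolation
open scoped Classical

namespace AutCyl

variable {W : Type} [DecidableEq W] {X : SimpleGraph W} {A : Type} [Group A] [MulAction A W] [X.LocallyFinite]

/-- **A connected locally finite graph with a cocompact action by automorphisms of a VIRTUALLY NILPOTENT group is AMENABLE** (quasi-transitive by the
action; polynomial growth by gen-1 g6's cocompact growth transfer restricted to the nilpotent finite-index subgroup + Wolf's theorem from the tree's Literature;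
polynomial ⟹ not exponential ⟹ amenable).  `x` witnesses non-emptiness. [cite: WolfGrowth1968, Thm. 3.2] [cite: LyonsPeres2016, §6.1 (growth and amenability)]
[cite: Woess2000, Lemma 3.13] -/
theorem isGraphAmenable_of_virtuallyNilpotent_cocompact (hact : IsActionByAut X A) (reps : Finset W)
    (hcover : ∀ w : W, ∃ a : A, ∃ r ∈ reps, a • r = w) (N : Subgroup A) [N.FiniteIndex] [Group.IsNilpotent N] (x : W) :
    IsGraphAmenable X := by
  obtain ⟨reps', hcover'⟩ := exists_reps_of_finiteIndex N reps hcover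
  obtain ⟨C, D, hCD⟩ := AutChart.exists_polynomialGrowth_of_cocompact (isActionByAut_subgroup hact N) reps' hcover' fun S => by
    obtain ⟨C, D, -, h⟩ := Literature.GroupTheory.Nilpotent.ballVolume_mulCayley_le_polynomial_of_isNilpotent S
    exact ⟨C, D, fun n => h 1 n⟩
  have hq : IsQuasiTransitive X := AutChart.isQuasiTransitive_of_finite_orbits hact reps hcover
  by_contra hna
  exact not_hasExponentialGrowth_of_polynomialGrowth X x ⟨C, D, fun y n => by exact_mod_cast hCD y n⟩
    (hasExponentialGrowth_of_not_isGraphAmenable X hq hna)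

/-- **`p_u = p_c(x)` for every connected locally finite graph with a cocompact action of a virtually nilpotent group** (any action: kernel, torsion,
stabilisers, finite generation arbitrary). [cite: LyonsPeres2016, Thm. 7.6, §7.5 (7.7)] [cite: BenjaminiSchramm1996, §2 (p. 73)] -/
theorem uniquenessProb_eq_criticalProb_of_virtuallyNilpotent_cocompact (hc : X.Connected) (hact : IsActionByAut X A) (reps : Finset W)
    (hcover : ∀ w : W, ∃ a : A, ∃ r ∈ reps, a • r = w) (N : Subgroup A) [N.FiniteIndex] [Group.IsNilpotent N] (x : W) :
    uniquenessProb X = criticalProb X x :=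
  uniquenessProb_eq_criticalProb_of_amenable X hc (AutChart.isQuasiTransitive_of_finite_orbits hact reps hcover)
    (isGraphAmenable_of_virtuallyNilpotent_cocompact hact reps hcover N x) x

/-- **QUESTION 3 / CONJ. 7.27 ON THE C2 ACTION CLASS**: for every action with finitely many orbits of a FINITELY GENERATED virtually nilpotent group by
automorphisms of a connected locally finite graph, `p_u < 1` UNLESS some element acts with finite index modulo the kernel (then the graph is a line or finite
up to finite fibres and `p_u = p_c = 1`).  Via `p_u = p_c` (this file) and the dichotomy «AutCocompactFinitelyGeneratedDichotomy» p596130.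
[cite: BenjaminiSchramm1996, Question 3 (p. 79), §2 Conj. 1] [cite: LyonsPeres2016, Conj. 7.27, Cor. 7.19] -/
theorem uniquenessProb_lt_one_of_fg_virtuallyNilpotent_cocompact [Group.FG A] (hc : X.Connected) (hact : IsActionByAut X A) (reps : Finset W)
    (hcover : ∀ w : W, ∃ a : A, ∃ r ∈ reps, a • r = w) (N : Subgroup A) [N.FiniteIndex] [Group.IsNilpotent N]
    (hncyc : ¬ ∃ a : A, (Subgroup.zpowers a ⊔ (MulAction.toPermHom A W).ker).FiniteIndex) (x : W) : uniquenessProb X < 1 := by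
  rw [uniquenessProb_eq_criticalProb_of_virtuallyNilpotent_cocompact hc hact reps hcover N x]
  exact (criticalProb_lt_one_iff_of_fg_virtuallyNilpotent hc hact reps hcover N x).2 hncyc

end AutCyl

end Summit.CriticalPhenomena.PercolationContinuityZ3.Theorems.Transplant

end
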